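import Summits.Ventures.CertifiedArithmetic.LowPrec.DoubleRoundingSlipParity

/-!
# Double rounding — precision gap one: slips land on ODD data of the wide format

HONEST FRAMING: certified error envelopes and provably optimal rounding/accumulation schemes for
low-precision formats under stated cost models; every table by two implementations; no hardware
or vendor claims.

`DoubleRoundingSlipParity.lean` shows that for `m_φ + 2 ≤ m_ψ` a slipped
round-to-nearest-even intermediate `fl_ψ x` is an EVEN datum of `ψ` (a midpoint of `φ` is even
in `ψ`, [BoldoMelquiond2008, Thm 3]).  With precision gap ONE the parity flips: for
`m_ψ = m_φ + 1` (`bias_φ ≤ bias_ψ`) the midpoint `v + ulp(v)/2` above a NORMAL value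
`v = c · ulp(v)` of `φ` (`2^m_φ ≤ c < 2^(m_φ+1)`) is `(2c + 1) · ulp(v)/2`, and `2c + 1` has
exactly `m_φ + 2 = m_ψ + 1` bits — it is the full significand of a normal datum of `ψ`, with odd
trailing part
(`not_two_dvd_man_of_toRat_eq_midpoint_succ`).  Hence in the gap-one cells (e3m2 into the
precision-4 FP8 formats, e2m3 into binary8p5) a slip `fl_φ (fl_ψ x) ≠ fl_φ x` whose intermediate
is at least the least normal value `2^m_φ · quantum φ` of `φ` lands on an ODD datum of `ψ`
(`not_two_dvd_man_roundNE_of_slip_succ`), and an EVEN intermediate of that size is never double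
rounded wrongly (`roundNE_roundNE_of_two_dvd_man_succ`).  The size hypothesis cannot be
dropped: below the normal range of `φ` the midpoints `(2j+1) · quantum φ / 2` are
`(2j+1) · 2^(bias_ψ - bias_φ)` quanta of `ψ`, even as soon as `bias_φ < bias_ψ` — e3m2 products
in e4m3 slip at `3/16 · 7/8 = 21/128 ↦ 5/32`, an even e4m3 datum (`slip_gap_one_instances`).
BELOW THE THRESHOLD the parity flips back (`two_dvd_man_of_toRat_eq_subnormal_midpoint`: for
`m_φ + 1 ≤ m_ψ` and `(m_ψ - m_φ) + (bias_ψ - bias_φ) ≥ 2` — with gap one: `bias_φ < bias_ψ` — the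
midpoint `v + quantum φ / 2` above a SUBNORMAL value `v` of `φ` is an even datum of `ψ`), so a
slip with `|fl_ψ x| < 2^m_φ · quantum φ` lands on an EVEN datum
(`two_dvd_man_roundNE_of_slip_below`) and the two halves combine into a complete PARITY TEST for
the gap-one cells with `bias_φ < bias_ψ` (e3m2 → e4m3 / binary8p4 / binary8p4f, e2m3 →
binary8p5): an intermediate that is even and at least `2^m_φ · quantum φ`, or odd and below it,
is never double rounded wrongly (`roundNE_roundNE_of_parity_test_succ`).

Implementation A: `code/enum/slip_midpoint_check.py` (SLIP-MIDPOINT.md: of the 675 slips of the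
four gap-one cells with an FP6 source, the 663 with `|fl_ψ x| ≥ 2^m_φ · quantum φ` have an odd
intermediate and the 12 below it — the e3m2 product `21/128 ↦ 5/32 < 1/4 = 2^2 · quantum e3m2`
in its operand orders, three cells — an even one; 0 violations of either law).
References: [MartinDorelMelquiondMuller2013] Property 2.1; [BoldoMelquiond2008] Thm 3, §III.A
(parity alternates along the grid); [Figueroa1995] §2.
-/

namespace Summit.Ventures.CertifiedArithmetic

open Literature.ComputerArithmetic.FloatingPoint
open Literature.ComputerArithmetic.FloatingPoint.Format
open Literature.ComputerArithmetic.FloatingPoint.MiniFloat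

/-- THE MIDPOINT IS ODD IN THE NEXT FORMAT: for `m_ψ = m_φ + 1`, `bias_φ ≤ bias_ψ`, a NORMAL
nonnegative value `v` of `φ` (`1 ≤ expCode v`) with ulp `G = 2^(expCode v - 1) · quantum φ`,
and any datum `z` of `ψ` with value `v + G/2`: the trailing significand of `z` is odd.
[cite: BoldoMelquiond2008, §III.A] -/
theorem not_two_dvd_man_of_toRat_eq_midpoint_succ {φ ψ : Format}
    (hm : ψ.manBits = φ.manBits + 1) (hb : φ.bias ≤ ψ.bias) {v : MiniFloat φ} (hv : 0 ≤ v.toRat)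
    (hvn : 1 ≤ v.expCode) (z : MiniFloat ψ)
    (hz : z.toRat = v.toRat + 2 ^ (v.expCode - 1) * φ.quantum / 2) : ¬ 2 ∣ z.man := by
  have hqφ := φ.quantum_pos
  have hqψ := ψ.quantum_pos
  set s := ψ.bias - φ.bias with hs_def
  have hquant : φ.quantum = 2 * 2 ^ s * ψ.quantum := by
    rw [quantum_eq_pow_mul_quantum (by omega) hb,
      show ψ.manBits - φ.manBits + (ψ.bias - φ.bias) = s + 1 by omega, pow_succ]
    ring
  set e := v.expCode - 1 with he_def
  obtain ⟨c, hc⟩ := pow_ulpExp_dvd_scaledMag v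
  have hcge : 2 ^ φ.manBits ≤ c := by
    have h1 := pow_le_scaledMag_of_expCode_pos v hvn
    rw [hc, pow_add, mul_comm (2 ^ φ.manBits) _] at h1
    exact Nat.le_of_mul_le_mul_left h1 (by positivity)
  -- the magnitude of `z` in `ψ`-quanta
  have hS : z.scaledMag = (2 * c + 1) * 2 ^ (e + s) := by
    apply scaledMag_eq_of_toRat_eq
    rw [hz, toRat_eq_toInt_mul, toInt_eq_scaledMag_of_nonneg hv, hc, hquant]
    push_cast; ring
  have hmψ : 1 ≤ ψ.manBits := by omega
  have hdvd : 2 ^ (z.expCode - 1) ∣ (2 * c + 1) * 2 ^ (e + s) := by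
    rw [← hS]; exact pow_ulpExp_dvd_scaledMag z
  -- the ulp exponent of `z` is exactly `e + s`
  have hle : z.expCode - 1 ≤ e + s := by
    by_contra hgt
    have h1 : 2 ^ (e + s + 1) ∣ (2 * c + 1) * 2 ^ (e + s) :=
      dvd_trans (Nat.pow_dvd_pow 2 (by omega)) hdvd
    rw [pow_succ, Nat.mul_comm (2 ^ (e + s)) 2,
      Nat.mul_dvd_mul_iff_right (Nat.two_pow_pos _)] at h1
    omega
  have hge : e + s ≤ z.expCode - 1 := by
    by_contra hlt
    have h1 := scaledMag_lt_pow_ulpExp z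
    have h2 : 2 ^ (ψ.manBits + 1 + (z.expCode - 1)) ≤ 2 ^ (ψ.manBits + (e + s)) :=
      Nat.pow_le_pow_right (by norm_num) (by omega)
    have h3 : 2 ^ (ψ.manBits + (e + s)) ≤ z.scaledMag := by
      rw [hS, pow_add]
      exact Nat.mul_le_mul_right _ (by rw [hm, pow_succ]; omega)
    omega
  have heq : z.expCode - 1 = e + s := le_antisymm hle hge
  rw [two_dvd_man_iff hmψ z, hS, heq]
  intro h
  rw [Nat.mul_comm 2 (2 ^ (e + s)), Nat.mul_comm (2 * c + 1) _,
    Nat.mul_dvd_mul_iff_left (Nat.two_pow_pos _)] at h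
  omega

/-- A SUBNORMAL value plus half a quantum stays below the normal range: for `expCode v = 0`,
`v + ulp(v)/2 < 2^m_φ · quantum φ`. [folklore] -/
theorem toRat_add_half_ulp_lt_of_expCode_eq_zero {φ : Format} {v : MiniFloat φ}
    (hv : 0 ≤ v.toRat) (h0 : v.expCode = 0) :
    v.toRat + 2 ^ (v.expCode - 1) * φ.quantum / 2 < 2 ^ φ.manBits * φ.quantum := by
  have hq := φ.quantum_pos
  have hsm : v.scaledMag = v.man := by simp [scaledMag, Format.scaled, h0]
  have hman : (v.man : ℚ) + 1 ≤ 2 ^ φ.manBits := by exact_mod_cast v.man_lt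
  rw [toRat_eq_toInt_mul, toInt_eq_scaledMag_of_nonneg hv, hsm, h0]
  push_cast
  nlinarith

/-- GAP ONE, POSITIVE ARGUMENTS: for `m_ψ = m_φ + 1`, `bias_φ ≤ bias_ψ`,
`maxRat_φ ≤ maxRat_ψ` and `0 < x` whose intermediate `fl_ψ x` is at least the least normal
value `2^m_φ · quantum φ` of `φ`: a slip `fl_φ (fl_ψ x) ≠ fl_φ x` forces `fl_ψ x` to be an ODD
datum of `ψ`.
[cite: MartinDorelMelquiondMuller2013, Property 2.1] -/
theorem not_two_dvd_man_roundNE_of_slip_succ_pos {φ ψ : Format}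
    (hm : ψ.manBits = φ.manBits + 1) (hb : φ.bias ≤ ψ.bias) (hmax : φ.maxRat ≤ ψ.maxRat)
    {x : ℚ} (hx : 0 < x) (hn : 2 ^ φ.manBits * φ.quantum ≤ (roundNE ψ x).toRat)
    (h : (roundNE φ (roundNE ψ x).toRat).toRat ≠ (roundNE φ x).toRat) :
    ¬ 2 ∣ (roundNE ψ x).man := by
  obtain ⟨v, u, hv0, hvx, hxu, hgap, hmid, -⟩ := slip_midpoint_of_pos (by omega) hb hmax hx h
  have hu := toRat_eq_add_ulp_of_consecutive hv0 (by linarith) hgap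
  have hvn : 1 ≤ v.expCode := by
    by_contra hlt
    have hval := toRat_add_half_ulp_lt_of_expCode_eq_zero hv0 (by omega)
    rw [hmid, hu] at hn
    linarith
  exact not_two_dvd_man_of_toRat_eq_midpoint_succ hm hb hv0 hvn _ (by rw [hmid, hu]; ring)

/-- GAP ONE, ALL ARGUMENTS: for `m_ψ = m_φ + 1`, `bias_φ ≤ bias_ψ`, `maxRat_φ ≤ maxRat_ψ`
and any rational `x` with `2^m_φ · quantum φ ≤ |fl_ψ x|`: a slip forces `fl_ψ x` to be an ODD
datum of `ψ`. [cite: MartinDorelMelquiondMuller2013, Property 2.1] -/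
theorem not_two_dvd_man_roundNE_of_slip_succ {φ ψ : Format}
    (hm : ψ.manBits = φ.manBits + 1) (hb : φ.bias ≤ ψ.bias) (hmax : φ.maxRat ≤ ψ.maxRat)
    {x : ℚ} (hn : 2 ^ φ.manBits * φ.quantum ≤ |(roundNE ψ x).toRat|)
    (h : (roundNE φ (roundNE ψ x).toRat).toRat ≠ (roundNE φ x).toRat) :
    ¬ 2 ∣ (roundNE ψ x).man := by
  have hq := φ.quantum_pos
  rcases lt_trichotomy x 0 with hneg | hzero | hpos
  · -- reduce to `-x > 0` by the sign symmetry of both roundings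
    have hx' : 0 < -x := by linarith
    have h' : (roundNE φ (roundNE ψ (-x)).toRat).toRat ≠ (roundNE φ (-x)).toRat := by
      rw [toRat_roundNE_neg, toRat_roundNE_neg, toRat_roundNE_neg]
      exact fun h'' => h (neg_injective h'')
    have hn' : 2 ^ φ.manBits * φ.quantum ≤ (roundNE ψ (-x)).toRat := by
      rw [toRat_roundNE_neg]
      have hle : (roundNE ψ x).toRat ≤ 0 := by
        have := toRat_roundNE_mono (φ := ψ) hneg.le
        rwa [toRat_roundNE_zero] at this
      rwa [abs_of_nonpos hle] at hn
    rw [← man_roundNE_neg]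
    exact not_two_dvd_man_roundNE_of_slip_succ_pos hm hb hmax hx' hn' h'
  · exfalso; apply h; subst hzero
    rw [toRat_roundNE_zero]
  · have hle : 0 ≤ (roundNE ψ x).toRat := by
      have := toRat_roundNE_mono (φ := ψ) hpos.le
      rwa [toRat_roundNE_zero] at this
    rw [abs_of_nonneg hle] at hn
    exact not_two_dvd_man_roundNE_of_slip_succ_pos hm hb hmax hpos hn h

/-- THE USER-FACING COROLLARY (gap one): an intermediate `fl_ψ x` that is an EVEN datum of `ψ` of
magnitude at least the least normal value of `φ` is never double rounded wrongly through `φ`, for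
`m_ψ = m_φ + 1`, `bias_φ ≤ bias_ψ`, `maxRat_φ ≤ maxRat_ψ`.
[cite: MartinDorelMelquiondMuller2013, Property 2.1] -/
theorem roundNE_roundNE_of_two_dvd_man_succ {φ ψ : Format}
    (hm : ψ.manBits = φ.manBits + 1) (hb : φ.bias ≤ ψ.bias) (hmax : φ.maxRat ≤ ψ.maxRat)
    {x : ℚ} (hn : 2 ^ φ.manBits * φ.quantum ≤ |(roundNE ψ x).toRat|)
    (heven : 2 ∣ (roundNE ψ x).man) :
    (roundNE φ (roundNE ψ x).toRat).toRat = (roundNE φ x).toRat := by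
  by_contra h
  exact not_two_dvd_man_roundNE_of_slip_succ hm hb hmax hn h heven

/-- KERNEL INSTANCES.  Gap one, normal range: the e2m3 product `5/8 · 15/8 = 75/64` slips
through binary8p5 (`19/16 ↦ 5/4` against `9/8`) and `19/16 = 2^0 · (1 + 3/16)` has binary8p5
significand `3`, odd.  Gap one, BELOW the normal range of `φ` (the size hypothesis is needed):
the e3m2 product `3/16 · 7/8 = 21/128` slips through e4m3 (`5/32 ↦ 1/8` against `3/16`) and
`5/32 = 2^(-3) · (1 + 2/8) < 1/4` has e4m3 significand `2`, even. -/
theorem slip_gap_one_instances :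
    ((roundNE Binary8p5 (75 / 64 : ℚ)).man = 3 ∧
      (roundNE E2M3 (roundNE Binary8p5 (75 / 64 : ℚ)).toRat).toRat = 5 / 4 ∧
      (roundNE E2M3 (75 / 64 : ℚ)).toRat = 9 / 8) ∧
    ((roundNE E4M3 (21 / 128 : ℚ)).toRat = 5 / 32 ∧ (roundNE E4M3 (21 / 128 : ℚ)).man = 2 ∧
      (roundNE E3M2 (roundNE E4M3 (21 / 128 : ℚ)).toRat).toRat = 1 / 8 ∧
      (roundNE E3M2 (21 / 128 : ℚ)).toRat = 3 / 16 ∧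
      (5 / 32 : ℚ) < 2 ^ E3M2.manBits * E3M2.quantum) := by
  refine ⟨⟨?_, ?_, ?_⟩, ?_, ?_, ?_, ?_, ?_⟩ <;> decide +kernel

/-! ### Below the normal range of `φ`: the parity flips back -/

/-- THE SUBNORMAL MIDPOINT IS EVEN IN THE WIDE FORMAT: for `m_φ + 1 ≤ m_ψ`, `bias_φ ≤ bias_ψ`
with `(m_ψ - m_φ) + (bias_ψ - bias_φ) ≥ 2` (two quanta of `ψ` per half-quantum of `φ`), a
SUBNORMAL nonnegative value `v` of `φ` (`expCode v = 0`, ulp = quantum) and any datum `z` of `ψ`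
with value `v + quantum φ / 2`: the trailing significand of `z` is even (`z = (2j+1) · 2^(t+1)`
quanta of `ψ` with `2j+1 < 2^(m_φ+1) ≤ 2^m_ψ`, too short to be a normal significand).
[cite: BoldoMelquiond2008, Thm 3] -/
theorem two_dvd_man_of_toRat_eq_subnormal_midpoint {φ ψ : Format}
    (hm : φ.manBits + 1 ≤ ψ.manBits) (hb : φ.bias ≤ ψ.bias)
    (hd : 2 ≤ (ψ.manBits - φ.manBits) + (ψ.bias - φ.bias)) {v : MiniFloat φ} (hv : 0 ≤ v.toRat)
    (h0 : v.expCode = 0) (z : MiniFloat ψ)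
    (hz : z.toRat = v.toRat + 2 ^ (v.expCode - 1) * φ.quantum / 2) : 2 ∣ z.man := by
  have hqφ := φ.quantum_pos
  have hqψ := ψ.quantum_pos
  obtain ⟨t, ht⟩ : ∃ t, (ψ.manBits - φ.manBits) + (ψ.bias - φ.bias) = t + 2 :=
    ⟨(ψ.manBits - φ.manBits) + (ψ.bias - φ.bias) - 2, by omega⟩
  have hquant : φ.quantum = 2 * 2 ^ (t + 1) * ψ.quantum := by
    rw [quantum_eq_pow_mul_quantum (by omega) hb, ht, pow_succ, pow_succ]; ring
  have hsm : v.scaledMag = v.man := by simp [scaledMag, Format.scaled, h0]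
  have hjlt : v.man < 2 ^ φ.manBits := v.man_lt
  -- the magnitude of `z` in `ψ`-quanta
  have hS : z.scaledMag = (2 * v.man + 1) * 2 ^ (t + 1) := by
    apply scaledMag_eq_of_toRat_eq
    rw [hz, toRat_eq_toInt_mul, toInt_eq_scaledMag_of_nonneg hv, hsm, h0, hquant]
    push_cast; ring
  have hmψ : 1 ≤ ψ.manBits := by omega
  rw [two_dvd_man_iff hmψ z, hS]
  have hdvd : 2 ^ (z.expCode - 1) ∣ (2 * v.man + 1) * 2 ^ (t + 1) := by
    rw [← hS]; exact pow_ulpExp_dvd_scaledMag z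
  have hle : z.expCode - 1 ≤ t + 1 := by
    by_contra hgt
    have h1 : 2 ^ (t + 1 + 1) ∣ (2 * v.man + 1) * 2 ^ (t + 1) :=
      dvd_trans (Nat.pow_dvd_pow 2 (by omega)) hdvd
    rw [pow_succ, Nat.mul_comm (2 ^ (t + 1)) 2,
      Nat.mul_dvd_mul_iff_right (Nat.two_pow_pos _)] at h1
    omega
  rcases Nat.lt_or_ge (z.expCode - 1) (t + 1) with hlt | hge
  · have h2 : 2 * 2 ^ (z.expCode - 1) ∣ 2 ^ (t + 1) := by
      rw [← pow_succ']; exact Nat.pow_dvd_pow 2 (by omega)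
    exact dvd_trans h2 (dvd_mul_left _ _)
  · exfalso
    have heq : z.expCode - 1 = t + 1 := le_antisymm hle hge
    have hpos : 1 ≤ z.expCode := by omega
    have hlow := pow_le_scaledMag_of_expCode_pos z hpos
    rw [hS, heq, pow_add] at hlow
    have h2 : 2 ^ ψ.manBits ≤ 2 * v.man + 1 := Nat.le_of_mul_le_mul_right hlow (by positivity)
    have h3 : 2 * v.man + 1 < 2 ^ (φ.manBits + 1) := by rw [pow_succ]; omega
    have h4 : 2 ^ (φ.manBits + 1) ≤ 2 ^ ψ.manBits := Nat.pow_le_pow_right (by norm_num) hm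
    omega

/-- A NORMAL value is at least the least normal value: `1 ≤ expCode v`, `0 ≤ v` imply
`2^m_φ · quantum φ ≤ v`. [folklore] -/
theorem pow_mul_quantum_le_toRat_of_expCode_pos {φ : Format} {v : MiniFloat φ}
    (hv : 0 ≤ v.toRat) (h1 : 1 ≤ v.expCode) : 2 ^ φ.manBits * φ.quantum ≤ v.toRat := by
  have hq := φ.quantum_pos
  have hlow := pow_le_scaledMag_of_expCode_pos v h1
  have h2 : 2 ^ φ.manBits ≤ v.scaledMag :=
    le_trans (Nat.pow_le_pow_right (by norm_num) (Nat.le_add_right _ _)) hlow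
  have h3 : ((2 : ℕ) ^ φ.manBits : ℚ) ≤ (v.scaledMag : ℚ) := by exact_mod_cast h2
  rw [toRat_eq_toInt_mul, toInt_eq_scaledMag_of_nonneg hv]
  push_cast at h3 ⊢
  exact mul_le_mul_of_nonneg_right h3 hq.le

/-- GAP ONE BELOW THE THRESHOLD, POSITIVE ARGUMENTS: for `m_ψ = m_φ + 1`, `bias_φ < bias_ψ`,
`maxRat_φ ≤ maxRat_ψ`, `0 < x` and `fl_ψ x < 2^m_φ · quantum φ`: a slip forces `fl_ψ x` to be
an EVEN datum of `ψ`. [cite: MartinDorelMelquiondMuller2013, Property 2.1] -/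
theorem two_dvd_man_roundNE_of_slip_below_pos {φ ψ : Format}
    (hm : ψ.manBits = φ.manBits + 1) (hb : φ.bias < ψ.bias) (hmax : φ.maxRat ≤ ψ.maxRat)
    {x : ℚ} (hx : 0 < x) (hlt : (roundNE ψ x).toRat < 2 ^ φ.manBits * φ.quantum)
    (h : (roundNE φ (roundNE ψ x).toRat).toRat ≠ (roundNE φ x).toRat) :
    2 ∣ (roundNE ψ x).man := by
  obtain ⟨v, u, hv0, hvx, hxu, hgap, hmid, -⟩ := slip_midpoint_of_pos (by omega) hb.le hmax hx h
  have hu := toRat_eq_add_ulp_of_consecutive hv0 (by linarith) hgap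
  have h0 : v.expCode = 0 := by
    by_contra hne
    have hge := pow_mul_quantum_le_toRat_of_expCode_pos hv0 (by omega)
    rw [hmid] at hlt
    linarith
  exact two_dvd_man_of_toRat_eq_subnormal_midpoint (by omega) hb.le (by omega) hv0 h0 _
    (by rw [hmid, hu]; ring)

/-- GAP ONE BELOW THE THRESHOLD, ALL ARGUMENTS: for `m_ψ = m_φ + 1`, `bias_φ < bias_ψ`,
`maxRat_φ ≤ maxRat_ψ` and any rational `x` with `|fl_ψ x| < 2^m_φ · quantum φ`: a slip forces
`fl_ψ x` to be an EVEN datum of `ψ`. [cite: MartinDorelMelquiondMuller2013, Property 2.1] -/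
theorem two_dvd_man_roundNE_of_slip_below {φ ψ : Format}
    (hm : ψ.manBits = φ.manBits + 1) (hb : φ.bias < ψ.bias) (hmax : φ.maxRat ≤ ψ.maxRat)
    {x : ℚ} (hlt : |(roundNE ψ x).toRat| < 2 ^ φ.manBits * φ.quantum)
    (h : (roundNE φ (roundNE ψ x).toRat).toRat ≠ (roundNE φ x).toRat) :
    2 ∣ (roundNE ψ x).man := by
  rcases lt_trichotomy x 0 with hneg | hzero | hpos
  · have hx' : 0 < -x := by linarith
    have h' : (roundNE φ (roundNE ψ (-x)).toRat).toRat ≠ (roundNE φ (-x)).toRat := by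
      rw [toRat_roundNE_neg, toRat_roundNE_neg, toRat_roundNE_neg]
      exact fun h'' => h (neg_injective h'')
    have hlt' : (roundNE ψ (-x)).toRat < 2 ^ φ.manBits * φ.quantum := by
      rw [toRat_roundNE_neg]
      have hle : (roundNE ψ x).toRat ≤ 0 := by
        have := toRat_roundNE_mono (φ := ψ) hneg.le
        rwa [toRat_roundNE_zero] at this
      rwa [abs_of_nonpos hle] at hlt
    rw [← man_roundNE_neg]
    exact two_dvd_man_roundNE_of_slip_below_pos hm hb hmax hx' hlt' h'
  · exfalso; apply h; subst hzero
    rw [toRat_roundNE_zero]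
  · have hle : 0 ≤ (roundNE ψ x).toRat := by
      have := toRat_roundNE_mono (φ := ψ) hpos.le
      rwa [toRat_roundNE_zero] at this
    rw [abs_of_nonneg hle] at hlt
    exact two_dvd_man_roundNE_of_slip_below_pos hm hb hmax hpos hlt h

/-- THE COMPLETE PARITY TEST FOR THE GAP-ONE CELLS WITH `bias_φ < bias_ψ` (e3m2 → e4m3 /
binary8p4 / binary8p4f, e2m3 → binary8p5): an intermediate `w = fl_ψ x` that is EVEN and at
least `2^m_φ · quantum φ` in magnitude, or ODD and below it, is never double rounded wrongly
through `φ`. [cite: MartinDorelMelquiondMuller2013, Property 2.1] -/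
theorem roundNE_roundNE_of_parity_test_succ {φ ψ : Format}
    (hm : ψ.manBits = φ.manBits + 1) (hb : φ.bias < ψ.bias) (hmax : φ.maxRat ≤ ψ.maxRat)
    {x : ℚ}
    (htest : (2 ^ φ.manBits * φ.quantum ≤ |(roundNE ψ x).toRat| ∧ 2 ∣ (roundNE ψ x).man) ∨
      (|(roundNE ψ x).toRat| < 2 ^ φ.manBits * φ.quantum ∧ ¬ 2 ∣ (roundNE ψ x).man)) :
    (roundNE φ (roundNE ψ x).toRat).toRat = (roundNE φ x).toRat := by
  by_contra h
  rcases htest with ⟨hn, heven⟩ | ⟨hlt, hodd⟩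
  · exact not_two_dvd_man_roundNE_of_slip_succ hm hb.le hmax hn h heven
  · exact hodd (two_dvd_man_roundNE_of_slip_below hm hb hmax hlt h)

end Summit.Ventures.CertifiedArithmetic
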